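import Literature.MathematicalPhysics.KineticTheory.PalmMismatchRing
import HarnessLib

/-!
# Palm-mismatch collision operator, II: theorems on the hard-tether harmonic ring

Topic `Literature/MathematicalPhysics/KineticTheory`; sequel of `PalmMismatchRing.lean` (definition
request `defn-palmMismatchOperator`, route CollisionNoise). All statements concern the objects defined
there (namespace `…KineticTheory.PalmMismatch`); everything here is proved.

## Contents

* Matrix algebra: conjugation of rank-one matrices, `tr(Q a bᵀ) = b·Qa`, symmetric/antisymmetric
  pairings vanish, bond sums of quadratic forms as traces against `Σ_x ∇_x∇_xᵀ`.
* Translation invariance of the ring: `Φ` is shift invariant, hence so is `Φ⁻¹`, and the Gibbs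
  stretch variance `λ₀,x = ℓ_r G_T ℓ_r*` is the same on every bond (`stretchVar_gibbsCov_eq`).
* `exchangeMatrix_mul_gibbsCov_mul_transpose` (`R_x G_T R_xᵀ = G_T`) and the **zeroth-order
  cancellation** `palmMismatchIncrement_gibbsCov`: `Δ_x(G_T) = R_x M⁺ R_xᵀ - M⁻ = 0` — under the Gibbs
  law the exchange maps the up-crossing Palm second moments exactly onto the down-crossing ones
  (`R_x u = u`, `R_x w = -w`), so tether collisions are invisible at equilibrium and the derivative of
  the Rice weight drops out of the linearised operator.
* Block relations of flow invariance for `A = [[0,1],[-Φ,0]]` (`IsFlowInvariantForm.blocks`,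
  `IsFlowInvariant.blocks`): `Q₂₁ = -Q₁₂` antisymmetric and commuting with `Φ`, `Q₁₁ = ΦQ₂₂`, etc.
* **Main theorem** `trace_mul_sum_palmTilt_eq_zero`: for `ω₂ > 0`, every flow-invariant symmetric
  `δC` and every flow-invariant symmetric form `Q`, `tr(Q · Σ_x palmTilt_x(δC)) = 0` — the `T^{-1/2}`
  Palm tilt has no flow-invariant matrix elements on the ring (proof: after the block reduction the
  three surviving terms are `tr(Q₂₂D₁₂(Φ-ω₂))`, `tr(Φ⁻¹Q₁₂D₂₂(Φ-ω₂))` and a quadratic form of the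
  antisymmetric `Φ⁻¹Q₁₂`, each a symmetric–antisymmetric pairing). Corollary
  `trace_mul_palmMismatchLin`: `tr(Q · palmMismatchLin δC) = 2 tr(Q · Σ_x (R_xδCR_xᵀ - δC))`, i.e. the
  flow-averaged linearised Palm collision field is TWICE the flow-averaged generator of the
  nearest-neighbour exchange noise [BasileBernardinJaraKomorowskiOlla2016, §1], at every temperature.

Numerical cross-checks (exact rational arithmetic on rings `n = 3,…,6`; central differences of the
nonlinear field `palmCollisionField` against `palmMismatchLin`, agreement `10⁻¹⁰`) are recorded in the
unit notes of the request.
-/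

noncomputable section

open Matrix Finset

namespace Literature.MathematicalPhysics.KineticTheory.PalmMismatch

variable {n : ℕ} [NeZero n]

/-! ### §1. Matrix algebra -/

section Algebra

variable {ι : Type*} [Fintype ι]

/-- `R (a bᵀ) Rᵀ = (Ra)(Rb)ᵀ`. [folklore] -/
theorem mul_vecMulVec_mul_transpose (R : Matrix ι ι ℝ) (a b : ι → ℝ) :
    R * vecMulVec a b * Rᵀ = vecMulVec (R *ᵥ a) (R *ᵥ b) := by
  rw [mul_vecMulVec, vecMulVec_mul, vecMul_transpose]

/-- `tr(Q a bᵀ) = bᵀ Q a`. [folklore] -/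
theorem trace_mul_vecMulVec (Q : Matrix ι ι ℝ) (a b : ι → ℝ) :
    trace (Q * vecMulVec a b) = b ⬝ᵥ Q *ᵥ a := by
  rw [mul_vecMulVec, trace_vecMulVec, dotProduct_comm]

/-- For symmetric `Q`: `a · Q b = b · Q a`. [folklore] -/
theorem dotProduct_mulVec_comm_of_symm {Q : Matrix ι ι ℝ} (hQ : Qᵀ = Q) (a b : ι → ℝ) :
    a ⬝ᵥ Q *ᵥ b = b ⬝ᵥ Q *ᵥ a := by
  rw [dotProduct_mulVec, ← mulVec_transpose, hQ, dotProduct_comm]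

/-- An antisymmetric matrix has vanishing quadratic form. [folklore] -/
theorem dotProduct_mulVec_self_eq_zero_of_transpose_eq_neg {K : Matrix ι ι ℝ} (hK : Kᵀ = -K)
    (a : ι → ℝ) : a ⬝ᵥ K *ᵥ a = 0 := by
  have h : a ⬝ᵥ K *ᵥ a = -(a ⬝ᵥ K *ᵥ a) := by
    conv_lhs => rw [dotProduct_mulVec, ← mulVec_transpose, hK, neg_mulVec, neg_dotProduct,
      dotProduct_comm]
  linarith

/-- `tr(S K) = 0` for `S` symmetric and `K` antisymmetric. [folklore] -/
theorem trace_mul_eq_zero_of_symm_of_antisymm {S K : Matrix ι ι ℝ} (hS : Sᵀ = S) (hK : Kᵀ = -K) :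
    trace (S * K) = 0 := by
  have h : trace (S * K) = -trace (S * K) := by
    conv_lhs => rw [← trace_transpose, transpose_mul, hS, hK, trace_mul_comm, Matrix.mul_neg,
      trace_neg]
  linarith

/-- Pairing of `Σ_x` quadratic forms with a bond sum: `Σ_x g_x · M g_x = tr(M Σ_x g_x g_xᵀ)`.
[folklore] -/
theorem sum_dotProduct_mulVec_eq_trace {κ : Type*} [Fintype κ] (M : Matrix ι ι ℝ) (g : κ → ι → ℝ) :
    ∑ x, g x ⬝ᵥ M *ᵥ g x = trace (M * ∑ x, vecMulVec (g x) (g x)) := by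
  rw [Matrix.mul_sum, trace_sum]
  refine Finset.sum_congr rfl fun x _ => ?_
  rw [trace_mul_vecMulVec]

end Algebra

/-! ### §2. Translation invariance of the ring -/

omit [NeZero n] in
/-- Bond patterns are translates of one another: `∇_x(y) = ∇_0(y - x)`. [folklore] -/
theorem siteGrad_apply_eq (x y : ZMod n) : siteGrad x y = siteGrad 0 (y - x) := by
  simp [siteGrad, Pi.single_apply, sub_eq_iff_eq_add']

/-- `Φ` is translation invariant: `Φ(a - x, b - x) = Φ(a, b)`. [folklore] -/
theorem forceMatrix_submatrix_shift (ω₂ : ℝ) (x : ZMod n) :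
    (forceMatrix n ω₂).submatrix (Equiv.subRight x) (Equiv.subRight x) = forceMatrix n ω₂ := by
  ext a b
  simp only [forceMatrix, bondLaplacian, submatrix_apply, Matrix.add_apply, Matrix.smul_apply,
    Matrix.sum_apply, vecMulVec_apply, Equiv.subRight_apply, smul_eq_mul]
  congr 1
  · simp [Matrix.one_apply]
  · calc ∑ z, siteGrad z (a - x) * siteGrad z (b - x)
          = ∑ z, (fun w => siteGrad 0 (a - w) * siteGrad 0 (b - w)) (Equiv.addRight x z) := by
            refine Finset.sum_congr rfl fun z _ => ?_
            simp only [siteGrad_apply_eq z, Equiv.coe_addRight]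
            congr 2 <;> abel
      _ = ∑ w, siteGrad 0 (a - w) * siteGrad 0 (b - w) :=
            Equiv.sum_comp (Equiv.addRight x) (fun w => siteGrad 0 (a - w) * siteGrad 0 (b - w))
      _ = ∑ z, siteGrad z a * siteGrad z b := by
            refine Finset.sum_congr rfl fun z _ => ?_
            simp only [siteGrad_apply_eq z a, siteGrad_apply_eq z b]

/-- **The Gibbs stretch variance is the same on every bond of the ring** (`λ₀,x = λ₀`).
[folklore] -/
theorem stretchVar_gibbsCov_eq (ω₂ T : ℝ) (x : ZMod n) :
    stretchVar (gibbsCov n ω₂ T) x = stretchVar (gibbsCov n ω₂ T) 0 := by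
  have key : ∀ y : ZMod n, stretchVar (gibbsCov n ω₂ T) y =
      T * (siteGrad (n := n) 0 ⬝ᵥ (forceMatrix n ω₂)⁻¹ *ᵥ siteGrad 0) := by
    intro y
    unfold stretchVar
    rw [gibbsCov_mulVec_stretchCovector]
    unfold stretchCovector
    rw [sumElim_dotProduct_sumElim, dotProduct_zero, add_zero, dotProduct_smul, smul_eq_mul]
    congr 1
    set e := Equiv.subRight y
    have hg : siteGrad y = siteGrad 0 ∘ e := funext fun z => siteGrad_apply_eq y z
    have hΦe : (forceMatrix n ω₂)⁻¹ = ((forceMatrix n ω₂)⁻¹).submatrix e e := by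
      rw [← inv_submatrix_equiv, forceMatrix_submatrix_shift]
    rw [hg]
    conv_lhs => rw [hΦe, submatrix_mulVec_equiv]
    rw [Function.comp_assoc, Equiv.self_comp_symm, Function.comp_id,
      comp_equiv_dotProduct_comp_equiv]
  rw [key x, key 0]


/-! ### §3. The exchange preserves Gibbs; zeroth-order cancellation -/

section Nontrivial

variable [Fact (1 < n)]

/-- `R_x G_T R_xᵀ = G_T` (the exchange preserves the Gibbs law). [folklore] -/
theorem exchangeMatrix_mul_gibbsCov_mul_transpose (ω₂ T : ℝ) (x : ZMod n) :
    exchangeMatrix x * gibbsCov n ω₂ T * (exchangeMatrix x)ᵀ = gibbsCov n ω₂ T := by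
  set G := gibbsCov n ω₂ T
  set P := vecMulVec (velCovector x) (velCovector x) with hP
  have hG : Gᵀ = G := gibbsCov_transpose (n := n) ω₂ T
  have hv : velCovector x ᵥ* G = T • velCovector x := by
    rw [← mulVec_transpose, hG, gibbsCov_mulVec_velCovector]
  have hPG : P * G = T • P := by rw [hP, vecMulVec_mul, hv, vecMulVec_smul]
  have hGP : G * P = T • P := by rw [hP, mul_vecMulVec, gibbsCov_mulVec_velCovector, smul_vecMulVec]
  have hPP : P * P = (2 : ℝ) • P := by
    rw [hP, vecMulVec_mul_vecMulVec, velCovector_dotProduct_self, vecMulVec_smul]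
  have hRt : (exchangeMatrix x)ᵀ = exchangeMatrix x := by
    simp [exchangeMatrix, transpose_sub]
  rw [hRt]
  show (1 - P) * G * (1 - P) = G
  rw [Matrix.sub_mul, Matrix.one_mul, hPG, Matrix.mul_sub, Matrix.mul_one, Matrix.sub_mul, hGP,
    Matrix.smul_mul, hPP, smul_smul, show T * 2 = T + T by ring, add_smul]
  abel

/-- **ZEROTH-ORDER CANCELLATION.** Under the Gibbs law the Palm-averaged second moments after the
exchange and after the free turnaround coincide: `Δ_x(G_T) = R_x M⁺ R_xᵀ - M⁻ = 0` (because
`R_x u = u`, `R_x w = w + d_x = -w`). So collisions are invisible at equilibrium to this order, and the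
derivative of the Rice weight does not enter the linearised operator. [folklore] -/
theorem palmMismatchIncrement_gibbsCov (ω₂ : ℝ) {T : ℝ} (hT : T ≠ 0) (x : ZMod n) :
    palmMismatchIncrement (gibbsCov n ω₂ T) x = 0 := by
  unfold palmMismatchIncrement palmSecondMoment
  set G := gibbsCov n ω₂ T
  set R := exchangeMatrix x
  set u := palmBump G x
  set w := palmDrift G x
  have hRu : R *ᵥ u = u := by
    rw [exchangeMatrix_mulVec, velCovector_dotProduct_palmBump_gibbsCov, zero_smul, sub_zero]
  have hRw : R *ᵥ w = -w := by
    rw [exchangeMatrix_mulVec, show w = (1 / 2 : ℝ) • velCovector x from palmDrift_gibbsCov ω₂ hT x,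
      dotProduct_smul, velCovector_dotProduct_self, smul_eq_mul, ← sub_smul, ← neg_smul]
    norm_num
  have hRG : R * G * Rᵀ = G := exchangeMatrix_mul_gibbsCov_mul_transpose ω₂ T x
  simp only [Matrix.mul_add, Matrix.add_mul, Matrix.mul_smul, Matrix.smul_mul,
    mul_vecMulVec_mul_transpose, hRu, hRw, hRG, vecMulVec_neg, neg_vecMulVec, neg_neg]
  simp only [one_mul, neg_mul, neg_smul, smul_add, smul_neg]
  abel

end Nontrivial

/-! ### §4. Block relations of flow invariance on `ℝ^n ⊕ ℝ^n` -/

section Blocks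

variable {m : Type*} [Fintype m] [DecidableEq m]

/-- Block form of `QA + AᵀQ = 0` for `A = [[0,1],[-Φ,0]]`, `Φ` symmetric:
`Q₂₁ = -Q₁₂`, `Q₁₁ = ΦQ₂₂ = Q₂₂Φ`, `ΦQ₁₂ = Q₁₂Φ`. [folklore] -/
theorem IsFlowInvariantForm.blocks {Φ : Matrix m m ℝ} (hΦ : Φᵀ = Φ) {Q : Matrix (m ⊕ m) (m ⊕ m) ℝ}
    (hQ : IsFlowInvariantForm (fromBlocks 0 1 (-Φ) 0) Q) :
    Q.toBlocks₂₁ = -Q.toBlocks₁₂ ∧ Q.toBlocks₁₁ = Φ * Q.toBlocks₂₂ ∧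
      Q.toBlocks₁₁ = Q.toBlocks₂₂ * Φ ∧ Φ * Q.toBlocks₁₂ = Q.toBlocks₁₂ * Φ := by
  unfold IsFlowInvariantForm at hQ
  rw [← fromBlocks_toBlocks Q, fromBlocks_transpose, fromBlocks_multiply, fromBlocks_multiply,
    fromBlocks_add, ← fromBlocks_zero, fromBlocks_inj] at hQ
  simp only [Matrix.mul_zero, Matrix.zero_mul, zero_add, add_zero, Matrix.mul_one, Matrix.one_mul,
    transpose_zero, transpose_one, transpose_neg, hΦ, Matrix.mul_neg, Matrix.neg_mul] at hQ
  obtain ⟨h11, h12, h21, h22⟩ := hQ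
  have e21 : Q.toBlocks₂₁ = -Q.toBlocks₁₂ := by
    rw [← sub_eq_zero]; convert h22 using 1; abel
  refine ⟨e21, ?_, ?_, ?_⟩
  · rw [← sub_eq_zero]; convert h12 using 1; abel
  · rw [← sub_eq_zero]; convert h21 using 1; abel
  · simp only [e21, Matrix.mul_neg, neg_neg] at h11
    rw [← sub_eq_zero]; convert h11 using 1; abel

/-- Block form of `AC + CAᵀ = 0` for `A = [[0,1],[-Φ,0]]`, `Φ` symmetric:
`C₂₁ = -C₁₂`, `C₂₂ = C₁₁Φ = ΦC₁₁`, `ΦC₁₂ = C₁₂Φ`. [folklore] -/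
theorem IsFlowInvariant.blocks {Φ : Matrix m m ℝ} (hΦ : Φᵀ = Φ) {C : Matrix (m ⊕ m) (m ⊕ m) ℝ}
    (hC : IsFlowInvariant (fromBlocks 0 1 (-Φ) 0) C) :
    C.toBlocks₂₁ = -C.toBlocks₁₂ ∧ C.toBlocks₂₂ = C.toBlocks₁₁ * Φ ∧
      C.toBlocks₂₂ = Φ * C.toBlocks₁₁ ∧ Φ * C.toBlocks₁₂ = C.toBlocks₁₂ * Φ := by
  unfold IsFlowInvariant at hC
  rw [← fromBlocks_toBlocks C, fromBlocks_transpose, fromBlocks_multiply, fromBlocks_multiply,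
    fromBlocks_add, ← fromBlocks_zero, fromBlocks_inj] at hC
  simp only [Matrix.mul_zero, Matrix.zero_mul, zero_add, add_zero, Matrix.mul_one, Matrix.one_mul,
    transpose_zero, transpose_one, transpose_neg, hΦ, Matrix.mul_neg, Matrix.neg_mul] at hC
  obtain ⟨h11, h12, h21, h22⟩ := hC
  have e21 : C.toBlocks₂₁ = -C.toBlocks₁₂ := by
    rw [← sub_eq_zero]; convert h11 using 1; abel
  refine ⟨e21, ?_, ?_, ?_⟩
  · rw [← sub_eq_zero]; convert h12 using 1; abel
  · rw [← sub_eq_zero]; convert h21 using 1; abel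
  · simp only [e21, Matrix.neg_mul, neg_neg] at h22
    rw [← sub_eq_zero, ← neg_eq_zero]; convert h22 using 1; abel

end Blocks

/-! ### §5. The Palm tilt is invisible to flow-invariant forms; `𝒦 = 2 ×` exchange -/

/-- **MAIN CANCELLATION.** On the pinned ring (`ω₂ > 0`, any `T`), for every flow-invariant
symmetric perturbation `δC` and every flow-invariant symmetric form `Q`, the bond sum of the Palm
tilts has zero `Q`-moment: `tr(Q · Σ_x (u_x m'_xᵀ + m'_x u_xᵀ)) = 0`. The proof uses the translation
invariance of the Gibbs stretch variance (`stretchVar_gibbsCov_eq`), `Σ_x ∇_x∇_xᵀ = Φ - ω₂` and the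
block relations of flow invariance: the three surviving terms are symmetric–antisymmetric pairings.
[folklore] -/
theorem trace_mul_sum_palmTilt_eq_zero {ω₂ : ℝ} (hω : 0 < ω₂) (T : ℝ)
    {Q δC : Matrix (PhaseIdx n) (PhaseIdx n) ℝ}
    (hQ : IsFlowInvariantForm (flowMatrix n ω₂) Q) (hQs : Qᵀ = Q)
    (hD : IsFlowInvariant (flowMatrix n ω₂) δC) (hDs : δCᵀ = δC) :
    trace (Q * ∑ x : ZMod n, palmTilt n ω₂ T x δC) = 0 := by
  -- notation
  set Φ := forceMatrix n ω₂ with hΦdef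
  have hΦ : Φᵀ = Φ := forceMatrix_transpose ω₂
  obtain ⟨hΦinv, hΦinv'⟩ := forceMatrix_mul_inv (n := n) hω
  have hΦit : (Φ⁻¹)ᵀ = Φ⁻¹ := forceMatrix_inv_transpose ω₂
  obtain ⟨q21, q11, q11', qc⟩ := IsFlowInvariantForm.blocks hΦ (by simpa [flowMatrix] using hQ)
  obtain ⟨d21, d22, d22', dc⟩ := IsFlowInvariant.blocks hΦ (by simpa [flowMatrix] using hD)
  set Q₁₁ := Q.toBlocks₁₁; set Q₁₂ := Q.toBlocks₁₂; set Q₂₁ := Q.toBlocks₂₁; set Q₂₂ := Q.toBlocks₂₂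
  set D₁₁ := δC.toBlocks₁₁; set D₁₂ := δC.toBlocks₁₂; set D₂₁ := δC.toBlocks₂₁; set D₂₂ := δC.toBlocks₂₂
  have hQeq : Q = fromBlocks Q₁₁ Q₁₂ Q₂₁ Q₂₂ := (fromBlocks_toBlocks Q).symm
  have hDeq : δC = fromBlocks D₁₁ D₁₂ D₂₁ D₂₂ := (fromBlocks_toBlocks δC).symm
  -- symmetry of blocks (`Qᵀ.toBlocks₂₁ = (Q.toBlocks₁₂)ᵀ` definitionally)
  have hQ12t : Q₁₂ᵀ = -Q₁₂ :=
    (congrArg Matrix.toBlocks₂₁ hQs : Q₁₂ᵀ = Q₂₁).trans q21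
  have hQ22t : Q₂₂ᵀ = Q₂₂ := (congrArg Matrix.toBlocks₂₂ hQs : Q₂₂ᵀ = Q₂₂)
  have hD12t : D₁₂ᵀ = -D₁₂ :=
    (congrArg Matrix.toBlocks₂₁ hDs : D₁₂ᵀ = D₂₁).trans d21
  have hD22t : D₂₂ᵀ = D₂₂ := (congrArg Matrix.toBlocks₂₂ hDs : D₂₂ᵀ = D₂₂)
  -- `Φ⁻¹` commutes with `Q₁₂` and `Φ⁻¹ Q₁₁ = Q₂₂`
  have hinvQ12 : Φ⁻¹ * Q₁₂ = Q₁₂ * Φ⁻¹ := by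
    calc Φ⁻¹ * Q₁₂ = Φ⁻¹ * Q₁₂ * (Φ * Φ⁻¹) := by rw [hΦinv, Matrix.mul_one]
      _ = Φ⁻¹ * (Q₁₂ * Φ) * Φ⁻¹ := by simp [Matrix.mul_assoc]
      _ = Φ⁻¹ * (Φ * Q₁₂) * Φ⁻¹ := by rw [qc]
      _ = (Φ⁻¹ * Φ) * Q₁₂ * Φ⁻¹ := by simp [Matrix.mul_assoc]
      _ = Q₁₂ * Φ⁻¹ := by rw [hΦinv', Matrix.one_mul]
  have hinvQ11 : Φ⁻¹ * Q₁₁ = Q₂₂ := by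
    rw [q11, ← Matrix.mul_assoc, hΦinv', Matrix.one_mul]
  have hK1 : (Φ⁻¹ * Q₁₂)ᵀ = -(Φ⁻¹ * Q₁₂) := by
    rw [transpose_mul, hΦit, hQ12t, Matrix.neg_mul, ← hinvQ12]
  have hK2 : (D₁₂ * Φ)ᵀ = -(D₁₂ * Φ) := by
    rw [transpose_mul, hΦ, hD12t, Matrix.mul_neg, dc]
  -- expand the trace pairing
  have hu : ∀ x, palmBump (gibbsCov n ω₂ T) x =
      ((stretchVar (gibbsCov n ω₂ T) 0)⁻¹ * T) • Sum.elim (Φ⁻¹ *ᵥ siteGrad x) 0 := by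
    intro x
    unfold palmBump
    rw [stretchVar_gibbsCov_eq ω₂ T x, gibbsCov_mulVec_stretchCovector, ← smul_smul]
    congr 1
    ext (i | i) <;> simp [hΦdef]
  set c₀ : ℝ := (stretchVar (gibbsCov n ω₂ T) 0)⁻¹ * T
  have hpair : ∀ x, trace (Q * palmTilt n ω₂ T x δC) =
      2 * (c₀ * T⁻¹) * (Sum.elim (Φ⁻¹ *ᵥ siteGrad x) 0 ⬝ᵥ Q *ᵥ
        (δC *ᵥ velCovector x - ((velCovector x ⬝ᵥ δC *ᵥ velCovector x) / 2) • velCovector x)) := by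
    intro x
    unfold palmTilt palmKick
    rw [hu x, Matrix.mul_add, trace_add, trace_mul_vecMulVec, trace_mul_vecMulVec,
      dotProduct_mulVec_comm_of_symm hQs (T⁻¹ • _), smul_dotProduct, mulVec_smul,
      dotProduct_smul]
    simp only [smul_eq_mul]
    ring
  -- each pairing in block form
  have hblock : ∀ x, Sum.elim (Φ⁻¹ *ᵥ siteGrad x) 0 ⬝ᵥ Q *ᵥ
      (δC *ᵥ velCovector x - ((velCovector x ⬝ᵥ δC *ᵥ velCovector x) / 2) • velCovector x) =
      siteGrad x ⬝ᵥ (Q₂₂ * D₁₂) *ᵥ siteGrad x +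
        siteGrad x ⬝ᵥ (Φ⁻¹ * Q₁₂ * D₂₂) *ᵥ siteGrad x -
        ((velCovector x ⬝ᵥ δC *ᵥ velCovector x) / 2) *
          (siteGrad x ⬝ᵥ (Φ⁻¹ * Q₁₂) *ᵥ siteGrad x) := by
    intro x
    set g := siteGrad x
    set c := (velCovector x ⬝ᵥ δC *ᵥ velCovector x) / 2
    have hv : δC *ᵥ velCovector x - c • velCovector x = Sum.elim (D₁₂ *ᵥ g) (D₂₂ *ᵥ g - c • g) := by
      unfold velCovector
      conv_lhs => rw [hDeq, fromBlocks_mulVec]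
      ext (i | i) <;> simp [g]
    rw [hv]
    conv_lhs => rw [hQeq, fromBlocks_mulVec]
    simp only [Sum.elim_comp_inl, Sum.elim_comp_inr, sumElim_dotProduct_sumElim, zero_dotProduct,
      add_zero]
    rw [mulVec_sub, mulVec_smul, dotProduct_add, dotProduct_sub, dotProduct_smul]
    -- move `Φ⁻¹` across: `(Φ⁻¹ g) · M v = g · (Φ⁻¹ M) v`
    have mv : ∀ (M : Matrix (ZMod n) (ZMod n) ℝ) (v : ZMod n → ℝ),
        (Φ⁻¹ *ᵥ g) ⬝ᵥ M *ᵥ v = g ⬝ᵥ (Φ⁻¹ * M) *ᵥ v := by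
      intro M v
      conv_rhs => rw [← mulVec_mulVec, dotProduct_mulVec, ← mulVec_transpose, hΦit]
    rw [mv, mv, mv, hinvQ11, smul_eq_mul]
    simp only [mulVec_mulVec, Matrix.mul_assoc]
    ring
  -- the quadratic form of the antisymmetric `Φ⁻¹ Q₁₂` vanishes termwise
  have hT3 : ∀ x, siteGrad x ⬝ᵥ (Φ⁻¹ * Q₁₂) *ᵥ siteGrad x = 0 := fun x =>
    dotProduct_mulVec_self_eq_zero_of_transpose_eq_neg hK1 _
  -- sum over bonds: `Σ g·Mg = tr(M (Φ - ω₂))`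
  have hL : ∑ x : ZMod n, vecMulVec (siteGrad x) (siteGrad x) = Φ - ω₂ • 1 := bondLaplacian_eq ω₂
  have hT1 : ∑ x : ZMod n, siteGrad x ⬝ᵥ (Q₂₂ * D₁₂) *ᵥ siteGrad x = 0 := by
    rw [sum_dotProduct_mulVec_eq_trace, hL, Matrix.mul_sub, trace_sub, Matrix.mul_smul,
      Matrix.mul_one, trace_smul, Matrix.mul_assoc,
      trace_mul_eq_zero_of_symm_of_antisymm hQ22t hK2,
      trace_mul_eq_zero_of_symm_of_antisymm hQ22t hD12t]
    simp
  have hT2 : ∑ x : ZMod n, siteGrad x ⬝ᵥ (Φ⁻¹ * Q₁₂ * D₂₂) *ᵥ siteGrad x = 0 := by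
    rw [sum_dotProduct_mulVec_eq_trace, hL, Matrix.mul_sub, trace_sub, Matrix.mul_smul,
      Matrix.mul_one, trace_smul]
    have e1 : trace (Φ⁻¹ * Q₁₂ * D₂₂ * Φ) = 0 := by
      rw [trace_mul_cycle, ← Matrix.mul_assoc, hΦinv, Matrix.one_mul,
        trace_mul_comm, trace_mul_eq_zero_of_symm_of_antisymm hD22t hQ12t]
    have e2 : trace (Φ⁻¹ * Q₁₂ * D₂₂) = 0 := by
      rw [trace_mul_comm, trace_mul_eq_zero_of_symm_of_antisymm hD22t hK1]
    rw [e1, e2]; simp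
  -- assemble
  rw [Matrix.mul_sum, trace_sum]
  simp_rw [hpair, hblock, hT3, mul_zero, sub_zero]
  rw [← Finset.mul_sum, Finset.sum_add_distrib, hT1, hT2]
  simp

/-- **`𝒦 = 2 ×` (flow-averaged exchange generator).** Under the hypotheses of
`trace_mul_sum_palmTilt_eq_zero`, every flow-invariant matrix element of the linearised Palm collision
field is twice that of the nearest-neighbour momentum-exchange increment:
`tr(Q · palmMismatchLin δC) = 2 tr(Q · Σ_x (R_x δC R_xᵀ - δC))`. [folklore] -/
theorem trace_mul_palmMismatchLin {ω₂ : ℝ} (hω : 0 < ω₂) (T : ℝ)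
    {Q δC : Matrix (PhaseIdx n) (PhaseIdx n) ℝ}
    (hQ : IsFlowInvariantForm (flowMatrix n ω₂) Q) (hQs : Qᵀ = Q)
    (hD : IsFlowInvariant (flowMatrix n ω₂) δC) (hDs : δCᵀ = δC) :
    trace (Q * palmMismatchLin n ω₂ T δC) =
      2 * trace (Q * ∑ x : ZMod n, exchangeIncrement x δC) := by
  unfold palmMismatchLin
  rw [Finset.sum_add_distrib, Matrix.mul_add, trace_add, ← Finset.smul_sum, ← Finset.smul_sum,
    Matrix.mul_smul, trace_smul, Matrix.mul_smul, trace_smul,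
    trace_mul_sum_palmTilt_eq_zero hω T hQ hQs hD hDs]
  simp

end Literature.MathematicalPhysics.KineticTheory.PalmMismatch
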